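import Summits.AtomisticToContinuum.HydrodynamicLimit.Theses.JParityClosure
import Summits.AtomisticToContinuum.HydrodynamicLimit.Theorems.JParityClosureAssemblyEnergyOneSided
import Summits.AtomisticToContinuum.HydrodynamicLimit.Theorems.JParityClosureParityBandClosureCoarseEntropy
import Summits.AtomisticToContinuum.HydrodynamicLimit.Theorems.JParityClosureParityBandClosureMomentumAtInstant
import Summits.AtomisticToContinuum.HydrodynamicLimit.Theorems.JParityClosureParityBandClosureEnergyFloor
import Summits.AtomisticToContinuum.HydrodynamicLimit.Theorems.JParityClosureParityInBandDensity
import HarnessLib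

/-!
# Crux `JParityClosure.ParityBandClosure` (stmt-AtomisticToContinuum-17608) — the TYPED SPLIT
# `MollifiedCloseTimeAveraged → EntropyNoDipAt → ParityBandClosure` (crux-strategist, route level)

`ParityBandClosure := OddContactSymmetry → EvenStressEnskog → RateFloor → LocalSecondLaw → DensityCap →
_root_.HydrodynamicLimit` is the closure step of route JParityClosure. Every registered line of the crux
(`Lines/Sketch.lean` (dead), `Lines/plain_entropy_finite_n_bf.lean`, `Lines/entropy_floor_fixes_energy.lean`,
`Lines/transfer_weighted_parity_chain.lean`) passes through the SAME typed waypoint, the time-averaged closure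
`MollifiedCloseTimeAveraged` (the `r`-cone-mollified empirical density / momentum / energy are `L¹(dx)`-close to the
guarded classical solution in time average over every window `[t, t+Δ] ⊂ [0,T)`), and every line must then pay the
passage to the INSTANT `t` — gap G1 of the Assembly twin 17595 (the fixed-time ENERGY third is invisible to the five
hypotheses used as black boxes: barrier note B1, `Cruxes/ParityBandClosure/IdeatorOneBarrierNotes.md`, phantom
conveyor). Line `entropy-floor-fixes-energy` (lead a1) LANDED the whole fixed-time readout modulo ONE new input, the
fixed-time local entropy floor `EntropyNoDipAt`:

* momentum third at the instant: `ParityBandClosureMomentumAtInstant.stub_momentumAtInstant` (p149671) from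
  `MollifiedCloseTimeAveraged`, `EvenStressEnskog`, `DensityCap`;
* energy third at the instant: `ParityBandClosureEnergyFloor.stub_energyFloorOfEntropyFloor` (p151116) from
  `CoarseEntropyIntegrable` (LANDED, `ParityBandClosureCoarseEntropy.stub_coarseEntropyIntegrable`, p148638),
  `EntropyNoDipAt`, `DensityCap` and the momentum third, plus the one-sidedness `Theorems.energyConjunct_of_lower`;
* density third at the instant: `ParityInBandDensity.parityInBand_densityField_of_densityCap` from `DensityCap`.

This file records the resulting DECOMPOSITION OF THE CRUX as a sorry-free theorem over the two typed pieces, written out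
VERBATIM as hypotheses (the waypoint texts of the skeleton; no new `Prop` constant is declared here — the pieces are filed
as the route's child items of `ParityBandClosure`, and this theorem is the split's glue by definitional unfolding):

  `parityBandClosure_of_subs : MollifiedCloseTimeAveraged → EntropyNoDipAt → JParityClosure.ParityBandClosure`.

Both pieces are statements about the hard-sphere dynamics in the GUARDED frame of the Statement (no implosion
exposure, Disproof §3), each STRICTLY WEAKER than the summit conjunct and neither giving the crux alone:
`_root_.HydrodynamicLimit → EntropyNoDipAt` is LANDED (`ParityBandClosureEntropyNoDipAtAnatomy.stub_entropyNoDipAtOfHydrodynamicLimit`,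
p151101), `_root_.HydrodynamicLimit → MollifiedCloseTimeAveraged` is the soft fixed-`r` uniform LLN + dominated convergence
in time (not needed here); `MollifiedCloseTimeAveraged ↛` the fixed-time energy third (G1, B1) and `EntropyNoDipAt ↛` the
momentum third (shear-to-heat at equal density / momentum / energy, line card). Of the crux's five hypotheses the split
consumes `EvenStressEnskog` and `DensityCap` at the instant; `OddContactSymmetry`, `RateFloor`, `LocalSecondLaw` (and the
route support `KineticEnergyTails` 13087) are the intended lemmas of the FIRST piece (kinetic half ⇒ weak stress isotropy ⇒
pressure value p136561 ⇒ relative-energy Grönwall), whose typing obstruction (`Lines/SketchDead.md`, restatement R-a/R-b of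
17722 / 13080) and external Grönwall inputs (13354 ∧ 13481 ∧ 13352, or the plain-`LocalSecondLaw` shell of line
`plain-entropy-finite-n-bf`) are untouched by this file.

Nothing here is sorried; axioms are the standard three.
-/

noncomputable section

namespace Summit.AtomisticToContinuum.HydrodynamicLimit.Theorems.ParityBandClosureSplit

open scoped BigOperators Topology Classical MeasureTheory ENNReal InnerProductSpace
open Filter Set MeasureTheory
open Literature.MathematicalPhysics.KineticTheory
open Literature.Analysis.FluidPDE
open Summit.AtomisticToContinuum.HydrodynamicLimit.Theses

/-! ## The split theorem (no `sorry`; the two pieces are HYPOTHESES written out verbatim — they become the route's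
child items `JParityClosure.MollifiedCloseTimeAveraged` / `JParityClosure.EntropyNoDipAt` by `route edit --split`, whose
bodies are these texts, so this theorem is the split's glue by definitional unfolding) -/

/-- **THE TYPED SPLIT OF THE CRUX.** `MollifiedCloseTimeAveraged → EntropyNoDipAt → JParityClosure.ParityBandClosure`:
the time-averaged closure of the mollified fields and the fixed-time entropy floor imply the closure crux, consuming
`EvenStressEnskog` and `DensityCap` from the crux's own hypotheses at the instant — momentum third by
`ParityBandClosureMomentumAtInstant.stub_momentumAtInstant` (p149671), energy third by
`ParityBandClosureEnergyFloor.stub_energyFloorOfEntropyFloor` (p151116) fed with the landed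
`ParityBandClosureCoarseEntropy.stub_coarseEntropyIntegrable` (p148638) and upgraded by `Theorems.energyConjunct_of_lower`,
density third by `ParityInBandDensity.parityInBand_densityField_of_densityCap`; thresholds `η₀ := min η₁ (min η₂ η₃)`,
`σ₀ := min σ₁ (min σ₂ σ₄)`; `TendstoHydroFieldsAt … t` assembled componentwise. This is the composition
`ParityBandClosure_of` of skeleton v3.2 of line `entropy-floor-fixes-energy` with its two un-landed inputs
(`windowClosure_of_stubs …` and `stub_entropyNoDipAt`) turned into hypotheses. [folklore] -/
theorem parityBandClosure_of_subs
    (hM : -- piece 1: `MollifiedCloseTimeAveraged`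
      ∃ η₀ : ℝ, 0 < η₀ ∧ ∀ (a₀ θ₀ : T3 → ℝ) (u₀ : T3 → V3), Continuous a₀ → Continuous θ₀ → Continuous u₀ →
      (∀ x, 0 < a₀ x) → (∀ x, 0 < θ₀ x) → ∃ σ₀ : ℝ, 0 < σ₀ ∧ ∀ σ : ℝ, 0 < σ → σ < σ₀ →
      ∀ (T : ℝ) (ρ θ : ℝ → T3 → ℝ) (u : ℝ → T3 → V3), IsHardSphereEulerSolution σ T ρ u θ →
      (∀ t ∈ Set.Ico 0 T, ∀ x, ρ t x * σ ^ 3 < η₀) →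
      ∀ Φ : (N : ℕ) → HardSphereFlow (Torus.geometry (Fin 3)) (hsDiameter σ N) (N + 1),
      TendstoHydroFieldsAt (fun N => localGibbsLaw σ a₀ u₀ θ₀ N (Φ N)) Φ ρ u θ 0 →
      ∀ t ∈ Set.Ico 0 T, ∀ Δ : ℝ, 0 < Δ → t + Δ < T → ∀ η δ : ℝ, 0 < η → 0 < δ →
      ∃ r₀ : ℝ, 0 < r₀ ∧ ∀ r : ℝ, 0 < r → r < r₀ → ∃ N₀ : ℕ, ∀ N : ℕ, N₀ ≤ N →
      let bx : T3 → T3 → ℝ := fun y x => 3 / (Real.pi * r ^ 3) * max (1 - Torus.euclidDist y x / r) 0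
      localGibbsLaw σ a₀ u₀ θ₀ N (Φ N)
      {z | η * Δ < ∫ s in Set.Icc t (t + Δ),
      ((∫ x, |empiricalDensityField ((Φ N).flow s z) (fun y => bx y x) - ρ s x|)
      + (∫ x, ‖empiricalMomentumField ((Φ N).flow s z) (fun y => bx y x) - ρ s x • u s x‖)
      + ∫ x, |empiricalEnergyField ((Φ N).flow s z) (fun y => bx y x) -
      totalEnergyDensity (ρ s x) (u s x) (θ s x)|)} ≤ ENNReal.ofReal δ)
    (hEnt : -- piece 2: `EntropyNoDipAt`
      ∃ η₀ : ℝ, 0 < η₀ ∧ ∀ (a₀ θ₀ : T3 → ℝ) (u₀ : T3 → V3), Continuous a₀ → Continuous θ₀ → Continuous u₀ →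
      (∀ x, 0 < a₀ x) → (∀ x, 0 < θ₀ x) → ∃ σ₀ : ℝ, 0 < σ₀ ∧ ∀ σ : ℝ, 0 < σ → σ < σ₀ →
      ∀ (T : ℝ) (ρ θ : ℝ → T3 → ℝ) (u : ℝ → T3 → V3), IsHardSphereEulerSolution σ T ρ u θ →
      (∀ t ∈ Set.Ico 0 T, ∀ x, ρ t x * σ ^ 3 < η₀) →
      ∀ Φ : (N : ℕ) → HardSphereFlow (Torus.geometry (Fin 3)) (hsDiameter σ N) (N + 1),
      TendstoHydroFieldsAt (fun N => localGibbsLaw σ a₀ u₀ θ₀ N (Φ N)) Φ ρ u θ 0 →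
      ∀ t ∈ Set.Ico 0 T, ∀ ψ : T3 → ℝ, Continuous ψ → (∀ x, 0 ≤ ψ x) → ∀ η δ : ℝ, 0 < η → 0 < δ →
      ∃ r₀ : ℝ, 0 < r₀ ∧ ∀ r : ℝ, 0 < r → r < r₀ → ∃ N₀ : ℕ, ∀ N : ℕ, N₀ ≤ N →
      let bx : T3 → T3 → ℝ := fun x y => 3 / (Real.pi * r ^ 3) * max (1 - Torus.euclidDist x y / r) 0
      let ρm : Config (N + 1) (Fin 3) T3 → T3 → ℝ := fun w x₀ => ∫ q, bx q.1 x₀ ∂(empiricalMeasure w)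
      let mm : Config (N + 1) (Fin 3) T3 → T3 → V3 := fun w x₀ => ∫ q, bx q.1 x₀ • q.2 ∂(empiricalMeasure w)
      let em : Config (N + 1) (Fin 3) T3 → T3 → ℝ := fun w x₀ =>
      ∫ q, bx q.1 x₀ * (‖q.2‖ ^ 2 / 2) ∂(empiricalMeasure w)
      let θm : Config (N + 1) (Fin 3) T3 → T3 → ℝ := fun w x₀ =>
      2 / 3 * (em w x₀ / ρm w x₀ - ‖mm w x₀‖ ^ 2 / (2 * ρm w x₀ ^ 2))
      let Hs : ℝ → ℝ → ℝ := fun a b =>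
      if 0 < a ∧ 0 < b then -(a * (3 / 2 * Real.log b - Real.log a - hsExcessFreeEnergy (a * σ ^ 3))) else 0
      localGibbsLaw σ a₀ u₀ θ₀ N (Φ N)
      {z | (∫ x : T3, ψ x * θ t x *
      (Hs (ρ t x) (θ t x) - Hs (ρm ((Φ N).flow t z) x) (θm ((Φ N).flow t z) x))) < -η} ≤ ENNReal.ofReal δ) :
    JParityClosure.ParityBandClosure := by
  intro hO hE hR hL hD
  have hMom := Summit.AtomisticToContinuum.HydrodynamicLimit.Theorems.ParityBandClosureMomentumAtInstant.stub_momentumAtInstant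
    hM hE hD
  have hEn := Summit.AtomisticToContinuum.HydrodynamicLimit.Theorems.ParityBandClosureEnergyFloor.stub_energyFloorOfEntropyFloor
    Summit.AtomisticToContinuum.HydrodynamicLimit.Theorems.ParityBandClosureCoarseEntropy.stub_coarseEntropyIntegrable
    hEnt hD hMom
  obtain ⟨η₁, hη₁, H₁⟩ := hMom
  obtain ⟨η₂, hη₂, H₂⟩ := hEn
  obtain ⟨η₃, hη₃, H₃⟩ := Summit.AtomisticToContinuum.HydrodynamicLimit.Theorems.energyConjunct_of_lower
  refine ⟨min η₁ (min η₂ η₃), lt_min hη₁ (lt_min hη₂ hη₃), fun a₀ θ₀ u₀ ha hθ hu ha0 hθ0 => ?_⟩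
  obtain ⟨σ₁, hσ₁, K₁⟩ := H₁ a₀ θ₀ u₀ ha hθ hu ha0 hθ0
  obtain ⟨σ₂, hσ₂, K₂⟩ := H₂ a₀ θ₀ u₀ ha hθ hu ha0 hθ0
  obtain ⟨σ₄, hσ₄, K₄⟩ :=
    Summit.AtomisticToContinuum.HydrodynamicLimit.Theorems.ParityInBandDensity.parityInBand_densityField_of_densityCap
      hD a₀ θ₀ u₀ ha hθ hu ha0 hθ0
  refine ⟨min σ₁ (min σ₂ σ₄), lt_min hσ₁ (lt_min hσ₂ hσ₄), fun σ hσ hσlt T ρ θ u hsol hguard Φ h0 t ht => ?_⟩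
  have hσ1 : σ < σ₁ := hσlt.trans_le (min_le_left _ _)
  have hσ2 : σ < σ₂ := hσlt.trans_le ((min_le_right _ _).trans (min_le_left _ _))
  have hσ4 : σ < σ₄ := hσlt.trans_le ((min_le_right _ _).trans (min_le_right _ _))
  have hg1 : ∀ s ∈ Set.Ico 0 T, ∀ x, ρ s x * σ ^ 3 < η₁ := fun s hs x =>
    (hguard s hs x).trans_le (min_le_left _ _)
  have hg2 : ∀ s ∈ Set.Ico 0 T, ∀ x, ρ s x * σ ^ 3 < η₂ := fun s hs x =>
    (hguard s hs x).trans_le ((min_le_right _ _).trans (min_le_left _ _))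
  have hg3 : ∀ s ∈ Set.Ico 0 T, ∀ x, ρ s x * σ ^ 3 < η₃ := fun s hs x =>
    (hguard s hs x).trans_le ((min_le_right _ _).trans (min_le_right _ _))
  have hDen := K₄ σ hσ hσ4 T ρ θ u hsol Φ h0 t ht
  have hMo := K₁ σ hσ hσ1 T ρ θ u hsol hg1 Φ h0 t ht
  have hLow := K₂ σ hσ hσ2 T ρ θ u hsol hg2 Φ h0 t ht
  have hEner := H₃ σ T a₀ θ₀ u₀ ρ θ u hσ hsol hg3 Φ h0 t ht hLow
  intro χ hχ δ hδ
  exact ⟨hDen χ hχ δ hδ, hMo χ hχ δ hδ, hEner χ hχ δ hδ⟩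

end Summit.AtomisticToContinuum.HydrodynamicLimit.Theorems.ParityBandClosureSplit

end
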